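import Summits.NavierStokesRegularity.OSWSelfSimilar.TypeIIInnerLimitMasterZoomData
import Summits.NavierStokesRegularity.OSWSelfSimilar.TypeIIInnerLimitMasterDatum
import Summits.NavierStokesRegularity.NavierStokesRegularity.Theorems.CertifiedBlowupCertifiedBlowupVorticityRateBlowupGaugeModulation
import HarnessLib

/-!
# Certificate class `CertifiedBlowupVorticityRateBlowup` (stmt-NavierStokesRegularity-8639): THE TYPE-(α) INNER OBJECT IS
# UNIVERSAL — every witness carries a TYPE-II-MODULATED gauge sequence (KNSS), and along it the Z1 inner object is the
# uniform unit stream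

Theorems file landed `--supports stmt-NavierStokesRegularity-8639` (cell `ns-blowup`, GROUP B zone Z1 «Type-II
log-modulated similarity ansatz» → the certificate crux; seventh crux-side deposit of the zone-Z1 seat, lead letter (kt)(4),
item D1). The zone's object is the modulation of the velocity gauge `λ_a(t) = ν/‖u(t)‖_∞` against the self-similar clock
`√(ν(T − t))`. Deposit 5 (`…GaugeModulation`, (K80)) proved: under the certificate `(T − t)‖ω(t)‖_∞ ≤ C_ω`, a gauge
subsequence with DIVERGING dimensionless vertex distance `d_k = ν(T − tₖ)/λₖ²` forces `curl W ≡ 0`, a CONSTANT inner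
object (α). This file adds the existence half and assembles:

* `not_typeI_quantitative` — **KNSS, quantitative form, for every maximal Leray–Hopf classical solution of finite lifespan
  from a rapidly decaying axisymmetric datum**: for every `N` some `(t, x) ∈ [0, T) × ℝ³` has
  `N < √(T − t)‖u(t, x)‖` (the tree's `not_isTypeIBlowup_of_isMaximalSmoothSolution` unfolded);
* `vorticityRate_witness_typeII_gauge_uniformStream` — **for every witness of the certificate class** there are Z1 gauge
  N-a zoom data `tₖ → T`, `λₖ > 0 → 0`, `(λₖ/ν)‖u‖ ≤ 1` on `[0, tₖ]`, near-max points `xₖ` with `(λₖ/ν)‖u(tₖ, xₖ)‖ → 1`,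
  centres `cₖ` with `‖xₖ − cₖ‖ ≤ Dλₖ`, bounded, every cluster point a SINGULAR point ON THE AXIS (one exists,
  `cylRadius cₖ → 0`), which are **TYPE-II-MODULATED — `ν(T − tₖ)/λₖ² → ∞`** (dictionary part XLII
  `exists_meridional_zoom_data_of_not_typeI` fed with KNSS) — and ONE subsequence `φ` along which the zoom converges to a
  KNSS blow-up limit `W` with the Oseen identity, the zoomed vorticity converges to `curl W`, AND **`W ≡ c` with
  `‖c‖ = 1`, `c_θ = c₁ = 0` (a swirl-free UNIFORM UNIT STREAM), the zoomed vorticity tending to `0`**: the (β) branch of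
  the master theorem on these data (`innerObject_master_core_of_zoomData`) carries a point with `curl W ≠ 0`, which
  (K80) `innerObject_curl_eq_zero_of_typeII_gauge` excludes along Type-II-modulated data.

ZONE-Z1 READING. For the certificate class the velocity gauge is BLIND at Type-II gauge times: zooming at the velocity
scale `λ = ν/‖u‖_∞` at near-record points of a Type-II-modulated record sequence shows a uniform stream and no vorticity —
and by KNSS such a sequence ALWAYS exists. The swirling core (β) of deposits 2–4 can therefore be seen ONLY along
Type-I-modulated gauge subsequences (K80); whether a witness has any is not decided here. No new definitions, no named-fact
hypotheses, no `sorry`. WHAT THIS IS NOT: not a blow-up or regularity claim — statements about a HYPOTHETICAL witness;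
crux 8639, crux 8640 and (AX-L) are untouched. Author: ns-blowup-profile-eng-1 g11, 2026-08-27.

## References
* G. Koch, N. Nadirashvili, G. Seregin, V. Šverák, Acta Math. 203 (2009), Thms 6.1–6.2 and §6 (proof of Prop. 6.1).
  [KochNadirashviliSereginSverak2009]
* G. Seregin, V. Šverák, Ann. Inst. H. Poincaré 26 (2009), Thm 1.1. [SereginSverak2009]
-/

-- the summit and its single problem share the name (D-0017 nested layout)
set_option linter.dupNamespace false

open MeasureTheory Set Function Filter Topology Metric
open scoped ENNReal NNReal

namespace Summit.NavierStokesRegularity.NavierStokesRegularity.Theorems.CertifiedBlowupVorticityRateBlowup.InnerObject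

open Literature.Analysis.FluidPDE
open Summit.NavierStokesRegularity.OSWSelfSimilar.TypeIIModulationDictionary
open Summit.NavierStokesRegularity.NavierStokesRegularity.Theorems.CertifiedBlowupAxisymBlowup.CompactAmplification

section TypeIIGauge

variable {ν T : ℝ} {u : ℝ → EuclideanSpace ℝ (Fin 3) → EuclideanSpace ℝ (Fin 3)}
  {p : ℝ → EuclideanSpace ℝ (Fin 3) → ℝ}

/-- **KNSS, quantitative form.** A maximal Leray–Hopf classical solution of finite lifespan `T > 0`, viscosity `ν > 0`,
from a rapidly decaying axisymmetric datum is not of Type I (`not_isTypeIBlowup_of_isMaximalSmoothSolution`); unfolded: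
for every `N` there are `t ∈ [0, T)` and `x` with `N < √(T − t)‖u(t, x)‖`.
[cite: KochNadirashviliSereginSverak2009, Thms 6.1–6.2] -/
theorem not_typeI_quantitative (hν : 0 < ν) (hT : 0 < T) (hmax : IsMaximalSmoothSolution ν 0 u p T)
    (hLH : IsLerayHopfOn T ν 0 (u 0) u) (hdec : HasRapidSpatialDecay (u 0)) (haxi : IsAxisymmetric (u 0))
    (N : ℝ) : ∃ t ∈ Ico 0 T, ∃ x : EuclideanSpace ℝ (Fin 3), N < Real.sqrt (T - t) * ‖u t x‖ := by
  have hnot := not_isTypeIBlowup_of_isMaximalSmoothSolution hν hT hmax hLH hdec haxi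
  by_contra h
  push Not at h
  refine hnot ⟨N, ?_⟩
  filter_upwards [Ico_mem_nhdsLT hT] with t ht x
  have hsq : 0 < Real.sqrt (T - t) := Real.sqrt_pos.2 (sub_pos.2 ht.2)
  rw [le_div_iff₀ hsq, mul_comm]
  exact h t ht x

/-- **CERTIFICATE-CLASS WITNESSES: A TYPE-II-MODULATED GAUGE SEQUENCE EXISTS, AND ALONG IT THE Z1 INNER OBJECT IS THE
UNIFORM UNIT STREAM.** For every `(ν, T, u, p)` of the certificate class (`IsMaximalSmoothSolution ν 0 u p T`,
Leray–Hopf from a rapidly decaying axisymmetric datum, `(T − t)‖ω(t, ·)‖_∞ ≤ C_ω` near `T⁻`): Z1 gauge N-a zoom data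
`tₖ ∈ [T/2, T)`, `tₖ → T`, `λₖ > 0 → 0`, `(λₖ/ν)‖u‖ ≤ 1` on `[0, tₖ] × ℝ³`, near-max points `xₖ` (`(λₖ/ν)‖u(tₖ, xₖ)‖ → 1`),
centres `cₖ` (`‖xₖ − cₖ‖ ≤ Dλₖ`, bounded, every cluster point singular and on the axis, one exists, `cylRadius cₖ → 0`),
**`ν(T − tₖ)/λₖ² → ∞` (Type-II modulation)**, and a subsequence `φ` with zoom `→ W` (KNSS blow-up limit, Oseen identity),
zoomed vorticity `→ curl W`, and **`W ≡ c`, `‖c‖ = 1`, `c₁ = 0`, zoomed vorticity `→ 0`**.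
[cite: KochNadirashviliSereginSverak2009, Thms 6.1–6.2 and §6 (proof of Prop. 6.1)] -/
theorem vorticityRate_witness_typeII_gauge_uniformStream (hν : 0 < ν) (hT : 0 < T)
    (hmax : IsMaximalSmoothSolution ν 0 u p T) (hLH : IsLerayHopfOn T ν 0 (u 0) u)
    (hdec : HasRapidSpatialDecay (u 0)) (haxi : IsAxisymmetric (u 0))
    (hrate : ∃ C : ℝ, ∀ᶠ t in 𝓝[<] T, ∀ x : EuclideanSpace ℝ (Fin 3), (T - t) * ‖curl (u t) x‖ ≤ C) :
    ∃ (tn lamn : ℕ → ℝ) (cn xn : ℕ → EuclideanSpace ℝ (Fin 3)) (φ : ℕ → ℕ)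
      (W : ℝ → EuclideanSpace ℝ (Fin 3) → EuclideanSpace ℝ (Fin 3)),
      (∀ k, T / 2 ≤ tn k ∧ tn k < T) ∧ Tendsto tn atTop (𝓝 T) ∧ (∀ k, 0 < lamn k) ∧ Tendsto lamn atTop (𝓝 0) ∧
      (∀ k, ∀ t ∈ Icc 0 (tn k), ∀ x, lamn k / ν * ‖u t x‖ ≤ 1) ∧
      Tendsto (fun k => lamn k / ν * ‖u (tn k) (xn k)‖) atTop (𝓝 1) ∧
      (∃ D : ℝ, ∀ k, ‖xn k - cn k‖ ≤ D * lamn k) ∧ (∃ R : ℝ, ∀ k, ‖cn k‖ ≤ R) ∧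
      (∀ x₀ : EuclideanSpace ℝ (Fin 3), MapClusterPt x₀ atTop cn → ¬ IsBoundedNearTop u T x₀ ∧ cylRadius x₀ = 0) ∧
      (∃ x₀ : EuclideanSpace ℝ (Fin 3), MapClusterPt x₀ atTop cn) ∧
      Tendsto (fun k => cylRadius (cn k)) atTop (𝓝 0) ∧
      Tendsto (fun k => ν * (T - tn k) / lamn k ^ 2) atTop atTop ∧
      StrictMono φ ∧ IsKNSSBlowupLimit W ∧
      (∀ s < 0, TendstoLocallyUniformly
        (fun k => ((lamn (φ k) / ν) • stPull (lamn (φ k) ^ 2 / ν) (lamn (φ k)) (tn (φ k)) (cn (φ k)) u) s)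
          (W s) atTop) ∧
      (∀ s t : ℝ, s < t → t < 0 → ∀ x,
        W t x = Literature.Analysis.UnboundedOperators.heatExtension (W s) (t - s) x - oseenDuhamel 1 s W W t x) ∧
      (∀ s < 0, ∀ y : EuclideanSpace ℝ (Fin 3), Tendsto (fun j => (lamn (φ j) ^ 2 / ν) •
        curl (u (tn (φ j) + lamn (φ j) ^ 2 / ν * s)) (cn (φ j) + lamn (φ j) • y)) atTop (𝓝 (curl (W s) y))) ∧
      (∃ c : EuclideanSpace ℝ (Fin 3), ‖c‖ = 1 ∧ c 1 = 0 ∧ ∀ s < 0, ∀ y : EuclideanSpace ℝ (Fin 3), W s y = c) ∧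
      ∀ s < 0, ∀ y : EuclideanSpace ℝ (Fin 3), Tendsto (fun j => (lamn (φ j) ^ 2 / ν) •
        curl (u (tn (φ j) + lamn (φ j) ^ 2 / ν * s)) (cn (φ j) + lamn (φ j) • y)) atTop (𝓝 0) := by
  obtain ⟨C, hC⟩ := hrate
  obtain ⟨Mₛ, hMₛ⟩ := hdec.abs_swirl_le
  -- ### Step 1: unit viscosity
  set v : ℝ → EuclideanSpace ℝ (Fin 3) → EuclideanSpace ℝ (Fin 3) := timeRescale ν⁻¹ ν⁻¹ u with hv
  have hνT : 0 < ν * T := mul_pos hν hT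
  have hmax' : IsMaximalSmoothSolution 1 0 v (timeRescale ν⁻¹ (ν⁻¹ ^ 2) p) (ν * T) := hmax.toUnitViscosity hν
  have hv0 : v 0 = ν⁻¹ • u 0 := by
    funext x
    simp [hv, timeRescale_apply]
  have hLH' : IsLerayHopfOn (ν * T) 1 0 (v 0) v := by
    have h := hLH.viscosityRescale (inv_pos.2 hν)
    rw [inv_mul_cancel₀ hν.ne', timeRescale_zero_force, div_inv_eq_mul, mul_comm T ν] at h
    rwa [hv0]
  have hdec' : HasRapidSpatialDecay (v 0) := by
    rw [hv0]
    exact SereginSverak2002_pressureOneSidedBound.hasRapidSpatialDecay_const_smul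
      (hmax.1.contDiff_velocity ⟨le_rfl, hT⟩) hdec ν⁻¹
  have haxi' : IsAxisymmetric (v 0) := by
    rw [hv0]
    exact haxi.const_smul ν⁻¹
  have hMₛ' : ∀ x, |swirl (v 0) x| ≤ Mₛ / ν := fun x => by
    have h := swirl_timeRescale_zero (u := u) hMₛ ν⁻¹ ν⁻¹ x
    rwa [abs_of_pos (inv_pos.2 hν), inv_mul_eq_div] at h
  -- ### Step 2: standing hypotheses for `v` on the slab, from the datum; KNSS (quantitative) for `v`
  have hbddv : ∀ S < ν * T, ∃ N : ℝ, 0 < N ∧ ∀ t ∈ Icc 0 S, ∀ x, ‖v t x‖ ≤ N := fun S hS => by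
    obtain ⟨M, hM⟩ := bounded_before_of_lerayHopf_classical one_pos hmax'.1 hLH' hdec' haxi' S hS
    exact ⟨max M 1, lt_max_of_lt_right one_pos, fun t ht x => (hM t ht x).trans (le_max_left _ _)⟩
  have haxiv : ∀ t ∈ Ico 0 (ν * T), IsAxisymmetric (v t) :=
    isAxisymmetric_slice_of_lerayHopf_classical one_pos hmax'.1 hLH' hdec' haxi'
  have hEv := energyBound_of_lerayHopf hLH'
  have hnIv : ∀ N : ℝ, ∃ t ∈ Ico 0 (ν * T), ∃ x : EuclideanSpace ℝ (Fin 3), N < Real.sqrt (ν * T - t) * ‖v t x‖ :=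
    not_typeI_quantitative one_pos hνT hmax' hLH' hdec' haxi'
  -- ### Step 3: freeze `v` to `0` off the slab `[0, νT)`
  set w : ℝ → EuclideanSpace ℝ (Fin 3) → EuclideanSpace ℝ (Fin 3) :=
    fun t => if 0 ≤ t ∧ t < ν * T then v t else 0 with hw
  have hw_eq : ∀ t ∈ Ico 0 (ν * T), w t = v t := fun t ht => by
    simp only [hw, if_pos (show 0 ≤ t ∧ t < ν * T from ⟨ht.1, ht.2⟩)]
  have h0I : (0 : ℝ) ∈ Ico 0 (ν * T) := ⟨le_rfl, hνT⟩
  have hclw : IsClassicalNSSolutionOn (Ico 0 (ν * T)) 1 0 w (timeRescale ν⁻¹ (ν⁻¹ ^ 2) p) :=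
    hmax'.1.congr_velocity hw_eq
  have haxiw : ∀ t, IsAxisymmetric (w t) := fun t => by
    by_cases ht : 0 ≤ t ∧ t < ν * T
    · rw [hw_eq t ht]
      exact haxiv t ht
    · have h0 : w t = 0 := by simp only [hw, if_neg ht]
      rw [h0]
      exact isAxisymmetric_zero
  have hEw : ∀ S < ν * T, ∃ C : ℝ≥0∞, C < ⊤ ∧ ∀ t ∈ Icc 0 S, ∫⁻ x, ‖w t x‖ₑ ^ 2 ≤ C := fun S hS => by
    obtain ⟨C, hC, hb⟩ := hEv S hS
    exact ⟨C, hC, fun t ht => by rw [hw_eq t ⟨ht.1, lt_of_le_of_lt ht.2 hS⟩]; exact hb t ht⟩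
  have hbddw : ∀ S < ν * T, ∃ N : ℝ, 0 < N ∧ ∀ t ∈ Icc 0 S, ∀ x, ‖w t x‖ ≤ N := fun S hS => by
    obtain ⟨N, hN, hb⟩ := hbddv S hS
    exact ⟨N, hN, fun t ht x => by rw [hw_eq t ⟨ht.1, lt_of_le_of_lt ht.2 hS⟩]; exact hb t ht x⟩
  have hMₛw : ∀ x, |swirl (w 0) x| ≤ Mₛ / ν := fun x => by
    rw [hw_eq 0 h0I]
    exact hMₛ' x
  have hnIw : ∀ N : ℝ, ∃ t ∈ Ico 0 (ν * T), ∃ x : EuclideanSpace ℝ (Fin 3),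
      N < Real.sqrt (ν * T - t) * ‖w t x‖ := fun N => by
    obtain ⟨t, ht, x, hx⟩ := hnIv N
    exact ⟨t, ht, x, by rwa [hw_eq t ht]⟩
  -- ### Step 4: Type-II-modulated meridional zoom data (part XLII) and the analytic core on them
  obtain ⟨tn₀, lamn₀, rn, zn, htn₀, hlam₀, hlam0₀, hrn, hgauge₀, hnear₀, hII₀⟩ :=
    exists_meridional_zoom_data_of_not_typeI hνT haxiw hbddw hnIw
  obtain ⟨htT₀, ψ, cn, φ, W, hψ, hdist, hφ, hW, hconv', hmild, hcurl', halt'⟩ :=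
    innerObject_master_core_of_zoomData hνT hclw haxiw hEw hbddw hMₛw htn₀ hlam₀ hlam0₀ hrn hgauge₀ hnear₀
  -- the data along `ψ`
  set tn' : ℕ → ℝ := tn₀ ∘ ψ with htn'def
  set lamn : ℕ → ℝ := lamn₀ ∘ ψ with hlamndef
  set xn : ℕ → EuclideanSpace ℝ (Fin 3) :=
    fun k => EuclideanSpace.single 0 (rn (ψ k)) + EuclideanSpace.single 2 (zn (ψ k)) with hxn
  have htn' : ∀ k, ν * T / 2 ≤ tn' k ∧ tn' k < ν * T := fun k => htn₀ (ψ k)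
  have htT' : Tendsto tn' atTop (𝓝 (ν * T)) := htT₀.comp hψ.tendsto_atTop
  have hlam : ∀ k, 0 < lamn k := fun k => hlam₀ (ψ k)
  have hlam0 : Tendsto lamn atTop (𝓝 0) := hlam0₀.comp hψ.tendsto_atTop
  have hgauge' : ∀ k, ∀ t ∈ Icc 0 (tn' k), ∀ x, lamn k * ‖w t x‖ ≤ 1 := fun k => hgauge₀ (ψ k)
  have hnear' : Tendsto (fun k => lamn k * ‖w (tn' k) (xn k)‖) atTop (𝓝 1) := hnear₀.comp hψ.tendsto_atTop
  have hII' : Tendsto (fun k => (ν * T - tn' k) / lamn k ^ 2) atTop atTop := hII₀.comp hψ.tendsto_atTop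
  have hcurl'' : ∀ s < 0, ∀ y : EuclideanSpace ℝ (Fin 3), Tendsto (fun j => lamn (φ j) ^ 2 •
      curl (w (tn' (φ j) + lamn (φ j) ^ 2 * s)) (cn (φ j) + lamn (φ j) • y)) atTop (𝓝 (curl (W s) y)) := hcurl'
  have hdist' : ∃ D : ℝ, ∀ k, ‖xn k - cn k‖ ≤ D * lamn k := hdist
  have hconv'' : ∀ s < 0, TendstoLocallyUniformly
      (fun k => (lamn (φ k) • stPull (lamn (φ k) ^ 2) (lamn (φ k)) (tn' (φ k)) (cn (φ k)) w) s) (W s) atTop := hconv'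
  -- ### Step 5: read back on `v` (the core never left the slab)
  have htnI : ∀ k, tn' k ∈ Ico 0 (ν * T) := fun k => ⟨le_trans (by positivity) (htn' k).1, (htn' k).2⟩
  have hzt : ∀ s : ℝ, s ≤ 0 → ∀ᶠ k in atTop, tn' (φ k) + lamn (φ k) ^ 2 * s ∈ Ico 0 (ν * T) := fun s hs =>
    eventually_zoomTime_mem_Ico (tn := tn' ∘ φ) (lamn := lamn ∘ φ) (fun k => htn' (φ k))
      (hlam0.comp hφ.tendsto_atTop) hνT hs
  have hgaugev : ∀ k, ∀ t ∈ Icc 0 (tn' k), ∀ x, lamn k * ‖v t x‖ ≤ 1 := fun k t ht x => by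
    rw [← hw_eq t ⟨ht.1, lt_of_le_of_lt ht.2 (htn' k).2⟩]
    exact hgauge' k t ht x
  have hnearv : Tendsto (fun k => lamn k * ‖v (tn' k) (xn k)‖) atTop (𝓝 1) :=
    hnear'.congr fun k => by rw [hw_eq _ (htnI k)]
  have hconvv : ∀ s < 0, TendstoLocallyUniformly
      (fun k => (lamn (φ k) • stPull (lamn (φ k) ^ 2) (lamn (φ k)) (tn' (φ k)) (cn (φ k)) v) s) (W s) atTop :=
    fun s hs => (hconv'' s hs).congr_inseparable ((hzt s hs.le).mono fun k hk y => Inseparable.of_eq (by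
      simp only [Pi.smul_apply, stPull_apply]
      rw [hw_eq _ hk]))
  have hcurlv : ∀ s < 0, ∀ y : EuclideanSpace ℝ (Fin 3), Tendsto (fun j => lamn (φ j) ^ 2 •
      curl (v (tn' (φ j) + lamn (φ j) ^ 2 * s)) (cn (φ j) + lamn (φ j) • y)) atTop (𝓝 (curl (W s) y)) :=
    fun s hs y => (hcurl'' s hs y).congr' ((hzt s hs.le).mono fun j hj => by rw [hw_eq _ hj])
  -- ### Step 6: read back on `u` (times `tₖ = ν⁻¹tₖ'`)
  have htime : ∀ k (s : ℝ), ν⁻¹ * (tn' (φ k) + lamn (φ k) ^ 2 * s) =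
      ν⁻¹ * tn' (φ k) + lamn (φ k) ^ 2 / ν * s := fun k s => by ring
  have hcurl : ∀ s < 0, ∀ y : EuclideanSpace ℝ (Fin 3), Tendsto (fun j => (lamn (φ j) ^ 2 / ν) •
      curl (u (ν⁻¹ * tn' (φ j) + lamn (φ j) ^ 2 / ν * s)) (cn (φ j) + lamn (φ j) • y)) atTop (𝓝 (curl (W s) y)) := by
    intro s hs y
    refine (hcurlv s hs y).congr fun j => ?_
    rw [hv, curl_timeRescale_slice, smul_smul, htime, div_eq_mul_inv, mul_comm (lamn (φ j) ^ 2) ν⁻¹]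
  set tn : ℕ → ℝ := fun k => ν⁻¹ * tn' k with htn_def
  have htn : ∀ k, T / 2 ≤ tn k ∧ tn k < T := fun k => by
    refine ⟨?_, ?_⟩
    · have h := (htn' k).1
      simp only [htn_def]
      rw [le_inv_mul_iff₀' hν]; linarith
    · have h := (htn' k).2
      simp only [htn_def]
      rw [inv_mul_lt_iff₀ hν]; linarith [mul_comm ν T]
  have htT : Tendsto tn atTop (𝓝 T) := by
    have h := htT'.const_mul ν⁻¹
    rwa [← mul_assoc, inv_mul_cancel₀ hν.ne', one_mul] at h
  have hgauge : ∀ k, ∀ t ∈ Icc 0 (tn k), ∀ x, lamn k / ν * ‖u t x‖ ≤ 1 := fun k t ht x => by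
    have hνt : ν * t ∈ Icc 0 (tn' k) := by
      refine ⟨mul_nonneg hν.le ht.1, ?_⟩
      have := ht.2
      simp only [htn_def] at this
      rw [le_inv_mul_iff₀' hν] at this
      linarith [mul_comm ν t]
    have h := hgaugev k (ν * t) hνt x
    rw [hv, timeRescale_apply, ← mul_assoc, inv_mul_cancel₀ hν.ne', one_mul, norm_smul, Real.norm_eq_abs,
      abs_of_pos (inv_pos.2 hν)] at h
    calc lamn k / ν * ‖u t x‖ = lamn k * (ν⁻¹ * ‖u t x‖) := by ring
      _ ≤ 1 := h
  have hnear : Tendsto (fun k => lamn k / ν * ‖u (tn k) (xn k)‖) atTop (𝓝 1) := by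
    refine hnearv.congr fun k => ?_
    rw [hv, timeRescale_apply, norm_smul, Real.norm_eq_abs, abs_of_pos (inv_pos.2 hν)]
    simp only [htn_def]
    ring
  have hII : Tendsto (fun k => ν * (T - tn k) / lamn k ^ 2) atTop atTop := by
    refine hII'.congr fun k => ?_
    simp only [htn_def]
    rw [mul_sub, ← mul_assoc, mul_inv_cancel₀ hν.ne', one_mul]
  -- ### Step 7: (C4)/(E0) — the centres accumulate on the singular set, on the axis
  have hblow : Tendsto (fun k => ‖u (tn k) (xn k)‖) atTop atTop :=
    tendsto_atTop_of_gauge_tendsto_one (μ := fun k => lamn k / ν) (fun k => div_pos (hlam k) hν)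
      (by simpa using hlam0.div_const ν) hnear
  obtain ⟨R, r, K, hr, hK⟩ := axisymmetricL3_boundedNearTop_infinity
    (axisymmetricL3Hyp_of_lerayHopf_classical hν hT hmax.1 hLH hdec haxi)
  have hxR : ∀ᶠ k in atTop, ‖xn k‖ < R := by
    have h1 : ∀ᶠ k in atTop, T - r ^ 2 < tn k := htT.eventually (lt_mem_nhds (by nlinarith))
    have h2 : ∀ᶠ k in atTop, K < ‖u (tn k) (xn k)‖ := hblow.eventually_gt_atTop K
    filter_upwards [h1, h2] with k hk1 hk2
    by_contra hle
    exact (not_le.2 hk2) (hK (tn k) ⟨hk1, (htn k).2⟩ (xn k) (not_lt.1 hle))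
  obtain ⟨D, hD⟩ := hdist'
  have hsub0 : Tendsto (fun k => ‖xn k - cn k‖) atTop (𝓝 0) :=
    squeeze_zero (fun k => norm_nonneg _) hD (by simpa using hlam0.const_mul D)
  have hcn_ev : ∀ᶠ k in atTop, ‖cn k‖ ≤ R + 1 := by
    have h3 : ∀ᶠ k in atTop, ‖xn k - cn k‖ < 1 := hsub0.eventually (gt_mem_nhds one_pos)
    filter_upwards [hxR, h3] with k hk hk3
    calc ‖cn k‖ = ‖xn k - (xn k - cn k)‖ := by rw [sub_sub_cancel]
      _ ≤ ‖xn k‖ + ‖xn k - cn k‖ := norm_sub_le _ _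
      _ ≤ R + 1 := by linarith
  obtain ⟨R', hR'⟩ := exists_forall_norm_le_of_eventually hcn_ev
  have hclus : ∀ x₀ : EuclideanSpace ℝ (Fin 3), MapClusterPt x₀ atTop cn →
      ¬ IsBoundedNearTop u T x₀ ∧ cylRadius x₀ = 0 := fun x₀ hx₀ => by
    have hnb := not_isBoundedNearTop_of_mapClusterPt htT (fun k => (htn k).2) hblow
      (mapClusterPt_of_tendsto_norm_sub hx₀ hsub0)
    exact ⟨hnb, cylRadius_eq_zero_of_not_isBoundedNearTop hν hT hmax.1 hLH hdec haxi hnb⟩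
  have hmem : ∀ k, cn k ∈ closedBall (0 : EuclideanSpace ℝ (Fin 3)) R' := fun k =>
    mem_closedBall_zero_iff.2 (hR' k)
  have hex : ∃ x₀ : EuclideanSpace ℝ (Fin 3), MapClusterPt x₀ atTop cn := by
    obtain ⟨a, -, ψ', hψ', hlim⟩ := tendsto_subseq_of_bounded (isBounded_closedBall
      (x := (0 : EuclideanSpace ℝ (Fin 3))) (r := R')) (x := cn) hmem
    exact ⟨a, (hlim.mapClusterPt).of_comp hψ'.tendsto_atTop⟩
  have hcyl : Tendsto (fun k => cylRadius (cn k)) atTop (𝓝 0) := by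
    refine tendsto_of_subseq_tendsto fun ns hns => ?_
    obtain ⟨a, -, ms, hms, hlim⟩ := tendsto_subseq_of_bounded (isBounded_closedBall
      (x := (0 : EuclideanSpace ℝ (Fin 3))) (r := R')) (x := cn ∘ ns) fun k => hmem (ns k)
    have ha : MapClusterPt a atTop cn := (hlim.mapClusterPt).of_comp (hns.comp hms.tendsto_atTop)
    refine ⟨ms, ?_⟩
    have h := (continuous_cylRadius.tendsto a).comp hlim
    rw [(hclus a ha).2] at h
    exact h
  -- ### Step 8: the (β) branch is excluded along Type-II-modulated data ((K80)); assemble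
  have hconvu : ∀ s < 0, TendstoLocallyUniformly
      (fun k => ((lamn (φ k) / ν) • stPull (lamn (φ k) ^ 2 / ν) (lamn (φ k)) (tn (φ k)) (cn (φ k)) u) s)
        (W s) atTop := fun s hs => by
    refine (hconvv s hs).congr fun k => ?_
    rw [hv, zoom_timeRescale]
    intro x
    rfl
  have hα : (∃ c : EuclideanSpace ℝ (Fin 3), ‖c‖ = 1 ∧ c 1 = 0 ∧ ∀ s < 0, ∀ y : EuclideanSpace ℝ (Fin 3), W s y = c) ∧
      ∀ s < 0, ∀ y : EuclideanSpace ℝ (Fin 3), Tendsto (fun j => lamn (φ j) ^ 2 •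
        curl (w (tn' (φ j) + lamn (φ j) ^ 2 * s)) (cn (φ j) + lamn (φ j) • y)) atTop (𝓝 0) := by
    rcases halt' with ⟨hc, hzero⟩ | ⟨-, -, -, -, -, ⟨s₀, hs₀, y₀, hne⟩, -⟩
    · exact ⟨hc, hzero⟩
    · exact absurd (innerObject_curl_eq_zero_of_typeII_gauge hν htn htT hlam hlam0 hφ hgauge hC hcurl
        (hII.comp hφ.tendsto_atTop) s₀ hs₀ y₀) hne
  obtain ⟨hc, hzero⟩ := hα
  refine ⟨tn, lamn, cn, xn, φ, W, htn, htT, hlam, hlam0, hgauge, hnear, ⟨D, hD⟩, ⟨R', hR'⟩, hclus, hex, hcyl, hII,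
    hφ, hW, hconvu, hmild, hcurl, hc, fun s hs y => ?_⟩
  refine ((hzero s hs y).congr' ((hzt s hs.le).mono fun j hj => by rw [hw_eq _ hj])).congr fun j => ?_
  rw [hv, curl_timeRescale_slice, smul_smul, htime, div_eq_mul_inv, mul_comm (lamn (φ j) ^ 2) ν⁻¹]

end TypeIIGauge

end Summit.NavierStokesRegularity.NavierStokesRegularity.Theorems.CertifiedBlowupVorticityRateBlowup.InnerObject
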